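import Summits.ValiantsHypothesis.ValiantsHypothesis.Theorems.FifoMatchingNNDivisionHardSwitchedFaceTowerFace
import HarnessLib

/-!
# The SWITCHED-FACE RUNGS, part 2: ★★ `towerSwitchRung_holds` (every 0-1 rank-one tower is decided, UNBUDGETED, Kaibel–Weltge rate), the general LOCATED-POINT rung, `SwitchedFaceRung`, `CorMinusCorRung` (§4–§6)

Theorems-side TRANSPLANT (port hand val-port-1 g3; crit-9 g1 CONFIRM 21:07:55Z «P-P2a′», director R298 (2), desk RULING #347 (A);
`--supports stmt-ValiantsHypothesis-21181 --as helper`) of val-idea-38 g1's crux workfile `Cruxes/NNDivisionHard/SwitchFaceTowerRung.lean`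
REV 4 FINAL @27833a3f9586 (sha16 9555358f6f12b67d, 909 l.; farm rc 0 / 0 sorry / 0 warnings; crit-9 g1 re-probes of rev 3 VERIFIED, axioms std)
— texts VERBATIM, namespace moved `…Cruxes.NNDivisionHard.SwitchFace` ↦ `…Theorems.FifoMatching.SwitchFace`, the 909-line file split by the
400-line cap into four modules `…SwitchedFaceTower(Face | · | Zonotope | Tolerant).lean` (§1–§3 / §4–§6 / §7 / §8–§9).  This module: §4 `towerSwitchRung_holds`, `tower_three_pow_le`, `zFull_three_pow_le`; §5 `located_point_rung`; §6 `SwitchExposed`, `switchedFaceRung_holds`, `corMinusCorRung_holds`, corollaries.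
Credit: statements + proofs val-idea-38 g1 (W5-P2, card `Cruxes/NNDivisionHard/Ideas/switched-face-psd-free.md`); critic of record val-idea-crit-9 g1.
HONEST FRAMING: kernel food for an OPEN crux — located-point / switched-face certificates decide CLASSES of passengers (every 0-1 rank-one tower,
`COR − COR`, ±PSD zonotopes, self-similar read fibres) at the Kaibel–Weltge rate; stmt-21181 `NNDivisionHard` OPEN; COR-VIRTUAL OPEN;
`VP ≠ VNP` NOT proved; nothing here is a summit statement.
-/

set_option autoImplicit false

-- the mandated summit-side namespace repeats a component by design (single-problem summit)
set_option linter.dupNamespace false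

noncomputable section

open Matrix Finset
open scoped Pointwise

namespace Summit.ValiantsHypothesis.ValiantsHypothesis.Theorems.FifoMatching.SwitchFace

open Literature.Barriers.PneNP (HasEFOfSize)
open Literature.Combinatorics.Optimization (corPolytopeGraph corVec)
open Summit.ValiantsHypothesis.ValiantsHypothesis.Theorems.FifoMatching.XcDivision
  (dot_le_of_mem_convexHull convexHull_range_inter_eq corVec_top_apply corPolytopeGraph_top_add_hull_three_pow_le)

variable {n : ℕ}

/-! ## §4 Assembly -/

/-- ★★ **THE TOWER RUNG HOLDS.** -/
theorem towerSwitchRung_holds : TowerSwitchRung := by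
  classical
  intro n P _ lam r h
  obtain ⟨C, hC⟩ := exists_switchFun (n := n + 1) 0
  -- the located face of the sum: `F_0 + {z₀}`
  have h1 := h.face_add_face₁ C 1 (hZ (C := C) P lam) (switch_valid 0 hC) (tower_valid P lam)
  rw [tower_face 0 hC P lam, Set.add_singleton] at h1
  -- translate back
  have h2 := h1.image_add_const (-vtx P lam (sgn (C := C) lam))
  rw [Set.image_image] at h2
  simp only [add_neg_cancel_right, Set.image_id'] at h2
  -- read the face
  rw [cor_face_eq 0 hC] at h2
  have h3 := h2.image_linearMap (delRead n 0)
  rwa [delRead_face 0 (switch_dot_corVec_eq_one_iff 0 hC)] at h3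

/-- COROLLARY: every 0-1 rank-one tower passenger is decided at Kaibel–Weltge rate, unconditionally:
`xc(COR(K_{n+1}) + Z) = r ⇒ 3^n ≤ (r+1)·2^n`. -/
theorem tower_three_pow_le (n : ℕ) (P : (Fin (n + 1) → Bool) → Prop) [DecidablePred P]
    (lam : (Fin (n + 1) → Bool) → ℝ) (r : ℕ)
    (h : HasEFOfSize (corPolytopeGraph (⊤ : SimpleGraph (Fin (n + 1))) + tower (n + 1) P lam) r) :
    3 ^ n ≤ (r + 1) * 2 ^ n :=
  Literature.Barriers.PneNP.corPolytopeGraph_top_three_pow_le (towerSwitchRung_holds n P lam r h)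

/-- `Z_full(K_{n+1}) = Σ_{all b} [−1,1]·bbᵀ` (all generators, unit weights): decided, unconditionally. -/
theorem zFull_three_pow_le (n r : ℕ)
    (h : HasEFOfSize (corPolytopeGraph (⊤ : SimpleGraph (Fin (n + 1))) +
      tower (n + 1) (fun _ => True) (fun _ => 1)) r) :
    3 ^ n ≤ (r + 1) * 2 ^ n :=
  tower_three_pow_le n _ _ r h

/-! ## §5 The general LOCATED-POINT rung (arbitrary index `a`, arbitrary valid functional tight exactly on `F_a`,
passenger with a unique maximising POINT over any index type) -/

/-- S3a′ — the `C`-face of `COR(K_n)` at any valid level `M` is the hull of the tight vertices. -/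
theorem cor_face_eq' {C : Fin n × Fin n → ℝ} {M : ℝ}
    (valid : ∀ b : Fin n → Bool, C ⬝ᵥ corVec (⊤ : SimpleGraph (Fin n)) b ≤ M) :
    corPolytopeGraph (⊤ : SimpleGraph (Fin n)) ∩ {x | C ⬝ᵥ x = M} =
      convexHull ℝ (Set.range fun b : {b : Fin n → Bool // C ⬝ᵥ corVec (⊤ : SimpleGraph (Fin n)) b = M} =>
        corVec (⊤ : SimpleGraph (Fin n)) b.1) := by
  unfold corPolytopeGraph
  exact convexHull_range_inter_eq _ C M valid

/-- the `C`-face of `conv{q j}` is ONE point when the maximiser is unique AS A POINT (ties only between equal points). -/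
theorem hull_face_singleton {m : ℕ} {J : Type} (q : J → (Fin m × Fin m → ℝ)) (C : Fin m × Fin m → ℝ) (j₀ : J)
    (huniq : ∀ j, C ⬝ᵥ q j < C ⬝ᵥ q j₀ ∨ q j = q j₀) :
    convexHull ℝ (Set.range q) ∩ {y | C ⬝ᵥ y = C ⬝ᵥ q j₀} = {q j₀} := by
  have hle : ∀ j, C ⬝ᵥ q j ≤ C ⬝ᵥ q j₀ := fun j => (huniq j).elim le_of_lt (fun h => by rw [h])
  rw [convexHull_range_inter_eq q C _ hle]
  have hr : (Set.range fun j : {j : J // C ⬝ᵥ q j = C ⬝ᵥ q j₀} => q j.1) = {q j₀} := by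
    ext y
    constructor
    · rintro ⟨⟨j, hj⟩, rfl⟩
      exact (huniq j).elim (fun hlt => absurd hj hlt.ne) id
    · intro hy
      rw [Set.mem_singleton_iff] at hy
      subst hy
      exact ⟨⟨j₀, rfl⟩, rfl⟩
  rw [hr, convexHull_singleton]

/-- ★★ **THE LOCATED-POINT RUNG** (engine behind `SwitchedFaceRung`, `TowerSwitchRung`, `CorMinusCorRung`): a functional `C` valid on
`COR(K_{n+1})` and tight EXACTLY on the switched face `F_a`, with a unique maximising point on the passenger `conv{q j}` (any index type),
transports an EF of `COR(K_{n+1}) + conv{q j}` of size `r` to an EF of `COR(K_n)` of size `r`. -/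
theorem located_point_rung {J : Type} (a : Fin (n + 1)) (C : Fin (n + 1) × Fin (n + 1) → ℝ) (M : ℝ)
    (valid : ∀ b : Fin (n + 1) → Bool, C ⬝ᵥ corVec (⊤ : SimpleGraph (Fin (n + 1))) b ≤ M)
    (tight : ∀ b : Fin (n + 1) → Bool, C ⬝ᵥ corVec (⊤ : SimpleGraph (Fin (n + 1))) b = M ↔ b a = true)
    (q : J → (Fin (n + 1) × Fin (n + 1) → ℝ)) (j₀ : J) (huniq : ∀ j, C ⬝ᵥ q j < C ⬝ᵥ q j₀ ∨ q j = q j₀) (r : ℕ)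
    (h : HasEFOfSize (corPolytopeGraph (⊤ : SimpleGraph (Fin (n + 1))) + convexHull ℝ (Set.range q)) r) :
    HasEFOfSize (corPolytopeGraph (⊤ : SimpleGraph (Fin n))) r := by
  have hle : ∀ j, C ⬝ᵥ q j ≤ C ⬝ᵥ q j₀ := fun j => (huniq j).elim le_of_lt (fun h => by rw [h])
  have hP : ∀ x ∈ corPolytopeGraph (⊤ : SimpleGraph (Fin (n + 1))), C ⬝ᵥ x ≤ M :=
    dot_le_of_mem_convexHull _ _ _ (by rintro _ ⟨b, rfl⟩; exact valid b)
  have hQ : ∀ y ∈ convexHull ℝ (Set.range q), C ⬝ᵥ y ≤ C ⬝ᵥ q j₀ :=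
    dot_le_of_mem_convexHull _ _ _ (by rintro _ ⟨j, rfl⟩; exact hle j)
  -- the located face of the sum: `F_a + {q j₀}`
  have h1 := h.face_add_face₁ C M (C ⬝ᵥ q j₀) hP hQ
  rw [hull_face_singleton q C j₀ huniq, Set.add_singleton] at h1
  -- translate back
  have h2 := h1.image_add_const (-q j₀)
  rw [Set.image_image] at h2
  simp only [add_neg_cancel_right, Set.image_id'] at h2
  -- read the face
  rw [cor_face_eq' valid] at h2
  have h3 := h2.image_linearMap (delRead n a)
  rwa [delRead_face a tight] at h3

/-! ## §6 The class `SwitchExposed` and two more named members: `SwitchedFaceRung`, `CorMinusCorRung` (same text as `SwitchFace.lean`) -/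

/-- ★ CLASS `SwitchExposed` (verbatim `SwitchFace.SwitchExposed`): some index `a` and some functional `C`, valid on `COR(K_{n+1})` and
tight exactly on `F_a`, have a UNIQUE maximising passenger point (ties only between equal points). -/
def SwitchExposed (n : ℕ) {K : ℕ} (q : Fin (K + 1) → (Fin (n + 1) × Fin (n + 1) → ℝ)) : Prop :=
  ∃ (a : Fin (n + 1)) (C : Fin (n + 1) × Fin (n + 1) → ℝ) (M : ℝ),
    (∀ b : Fin (n + 1) → Bool, C ⬝ᵥ corVec ⊤ b ≤ M) ∧ (∀ b : Fin (n + 1) → Bool, C ⬝ᵥ corVec ⊤ b = M ↔ b a = true) ∧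
      ∃ j₀, ∀ j, C ⬝ᵥ q j < C ⬝ᵥ q j₀ ∨ q j = q j₀

/-- ★★ **SWITCHED-FACE RUNG** (verbatim `SwitchFace.SwitchedFaceRung`). -/
def SwitchedFaceRung : Prop :=
  ∀ (n K : ℕ) (q : Fin (K + 1) → (Fin (n + 1) × Fin (n + 1) → ℝ)) (r : ℕ), SwitchExposed n q →
    HasEFOfSize (corPolytopeGraph (⊤ : SimpleGraph (Fin (n + 1))) + convexHull ℝ (Set.range q)) r →
      HasEFOfSize (corPolytopeGraph (⊤ : SimpleGraph (Fin n))) r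

/-- ★★ **THE SWITCHED-FACE RUNG HOLDS.** -/
theorem switchedFaceRung_holds : SwitchedFaceRung := by
  intro n K q r hq h
  obtain ⟨a, C, M, valid, tight, j₀, huniq⟩ := hq
  exact located_point_rung a C M valid tight q j₀ huniq r h

/-- COROLLARY: switch-exposed passengers are decided at Kaibel–Weltge rate `3^n ≤ (r+1)·2^n`. -/
theorem switchExposed_three_pow_le (n K : ℕ) (q : Fin (K + 1) → (Fin (n + 1) × Fin (n + 1) → ℝ)) (r : ℕ)
    (hq : SwitchExposed n q)
    (h : HasEFOfSize (corPolytopeGraph (⊤ : SimpleGraph (Fin (n + 1))) + convexHull ℝ (Set.range q)) r) :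
    3 ^ n ≤ (r + 1) * 2 ^ n :=
  Literature.Barriers.PneNP.corPolytopeGraph_top_three_pow_le (switchedFaceRung_holds n K q r hq h)

/-- ★ **DIFFERENCE BODY** rung (verbatim `SwitchFace.CorMinusCorRung`): `xc(COR(K_{n+1}) − COR(K_{n+1})) ≥ xc(COR(K_n))`. -/
def CorMinusCorRung : Prop :=
  ∀ (n r : ℕ), HasEFOfSize (corPolytopeGraph (⊤ : SimpleGraph (Fin (n + 1))) +
      (-corPolytopeGraph (⊤ : SimpleGraph (Fin (n + 1))))) r →
    HasEFOfSize (corPolytopeGraph (⊤ : SimpleGraph (Fin n))) r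

/-- `−COR` as the hull of the negated vertices. -/
theorem neg_cor_eq (m : ℕ) :
    -corPolytopeGraph (⊤ : SimpleGraph (Fin m)) =
      convexHull ℝ (Set.range fun b : Fin m → Bool => -corVec (⊤ : SimpleGraph (Fin m)) b) := by
  show -convexHull ℝ (Set.range (corVec (⊤ : SimpleGraph (Fin m)))) = _
  rw [← convexHull_neg, Set.neg_range]

/-- ★ **THE DIFFERENCE-BODY RUNG HOLDS**: the switching functional `C^{(0)}` has the UNIQUE minimiser `b = univ ∖ {0}` on `{0,1}^{n+1}`,
so its face on `−COR` is one vertex and `located_point_rung` applies. -/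
theorem corMinusCorRung_holds : CorMinusCorRung := by
  classical
  intro n r h
  obtain ⟨C, hC⟩ := exists_switchFun (n := n + 1) 0
  rw [neg_cor_eq] at h
  let b₀ : Fin (n + 1) → Bool := fun p => decide (p ≠ 0)
  have hb₀a : b₀ 0 = false := by simp [b₀]
  have hb₀p : ∀ p : Fin (n + 1), p ≠ 0 → b₀ p = true := fun p hp => by simp [b₀, hp]
  -- the off-face value `S b = Σ_{p ≠ 0, b p} (−2)` is termwise minimised at `b₀`
  have hterm : ∀ (b : Fin (n + 1) → Bool) (p : Fin (n + 1)),
      (if p ≠ 0 then (if b₀ p = true then (-2 : ℝ) else 0) else 0) ≤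
        (if p ≠ 0 then (if b p = true then (-2 : ℝ) else 0) else 0) := by
    intro b p
    by_cases hp : p ≠ 0
    · rw [if_pos hp, if_pos hp, if_pos (hb₀p p hp)]
      split_ifs <;> norm_num
    · rw [if_neg hp, if_neg hp]
  have hm0 : (∑ p : Fin (n + 1), if p ≠ 0 then (if b₀ p = true then (-2 : ℝ) else 0) else 0) ≤ 0 :=
    Finset.sum_nonpos fun p _ => by split_ifs <;> norm_num
  refine located_point_rung 0 C 1 (switch_dot_corVec_le 0 hC) (switch_dot_corVec_eq_one_iff 0 hC) _ b₀ ?_ r h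
  intro b
  show C ⬝ᵥ (-corVec ⊤ b) < C ⬝ᵥ (-corVec ⊤ b₀) ∨ -corVec ⊤ b = -corVec ⊤ b₀
  rw [dotProduct_neg, dotProduct_neg, switch_dot_corVec 0 hC b, switch_dot_corVec 0 hC b₀,
    if_neg (show ¬ b₀ 0 = true by rw [hb₀a]; exact Bool.false_ne_true)]
  by_cases hba : b 0 = true
  · left
    rw [if_pos hba]
    linarith
  · rw [if_neg hba]
    rcases lt_or_eq_of_le (Finset.sum_le_sum fun p (_ : p ∈ Finset.univ) => hterm b p) with hlt | heq
    · left
      linarith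
    · right
      have hall := (Finset.sum_eq_sum_iff_of_le fun p (_ : p ∈ Finset.univ) => hterm b p).1 heq
      have hbb : b = b₀ := by
        funext p
        by_cases hp : p = 0
        · subst hp
          rw [hb₀a]
          exact Bool.eq_false_iff.mpr hba
        · have hq := hall p (Finset.mem_univ p)
          rw [if_pos hp, if_pos hp, if_pos (hb₀p p hp)] at hq
          by_contra hbp
          rw [if_neg (fun h' => hbp (h'.trans (hb₀p p hp).symm))] at hq
          norm_num at hq
      rw [hbb]

/-- COROLLARY: `xc(COR(K_{n+1}) − COR(K_{n+1})) = r ⇒ 3^n ≤ (r+1)·2^n`. -/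
theorem corMinusCor_three_pow_le (n r : ℕ)
    (h : HasEFOfSize (corPolytopeGraph (⊤ : SimpleGraph (Fin (n + 1))) +
      (-corPolytopeGraph (⊤ : SimpleGraph (Fin (n + 1))))) r) :
    3 ^ n ≤ (r + 1) * 2 ^ n :=
  Literature.Barriers.PneNP.corPolytopeGraph_top_three_pow_le (corMinusCorRung_holds n r h)

end Summit.ValiantsHypothesis.ValiantsHypothesis.Theorems.FifoMatching.SwitchFace

end
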